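import Mathlib
import HarnessLib

/-!
# Prime divisors of integer polynomials (Schur 1912) and primes of complete splitting

Two classical elementary facts about a polynomial `f ∈ ℤ[X]`, **proved** in this file (plain
theorems, no named-fact `Prop` defs are needed since nothing is left unproved):

* `Literature.NumberTheory.Sieve.schur_exists_prime_dvd_eval` (alias `…_holds`) — Schur's theorem (1912): a non-constant `f ∈ ℤ[X]` has
  infinitely many *prime divisors*, i.e. for every bound `N` there is a prime `p > N` and an
  integer `a` with `p ∣ f(a)`.  Proof (Schur's Euclid-style argument): if `c = f(0) ≠ 0` then
  `f(c·N!·t) = c · (1 + N!·(…))`, and a value of the non-constant polynomial `t ↦ f(c N! t)` of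
  absolute value `≥ 2|c|` produces a prime factor of the second factor, necessarily `> N`.
* `Literature.NumberTheory.Sieve.exists_prime_gt_map_int_splits` (alias `…_holds`) — the "poor man's Chebotarev theorem": a non-zero
  `f ∈ ℤ[X]` factors into linear factors modulo `p` for infinitely many primes `p` (the set
  `Spl(f)` is infinite).  Proof: let `K/ℚ` be the splitting field of `f`, `θ ∈ K` a primitive
  element which is integral over `ℤ`, `g = minpoly_ℤ(θ)`.  Every root `ρ` of `f` in `K` satisfies
  `b_ρ ρ = r_ρ(θ)` with `b_ρ ∈ ℤ ∖ 0`, `r_ρ ∈ ℤ[X]`.  By Schur's theorem there are arbitrarily large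
  primes `p` with `p ∣ g(a)` for some `a ∈ ℤ`; evaluation `X ↦ a (mod p)` is a ring map
  `ψ : ℤ[X] → 𝔽_p` killing `g`, hence killing every integer polynomial vanishing at `θ`
  (`minpoly.isIntegrallyClosed_dvd`), so the identity
  `(∏ b_ρ) · f(Y) = lc(f) · ∏ (b_ρ Y − r_ρ(θ))` in `K[Y]`, which lifts to `ℤ[X][Y]` modulo `ker`,
  maps under `ψ` to a factorisation of `(∏ b_ρ) · f̄` into linear factors over `𝔽_p`.

These are the number-theoretic input for the elementary proof of the existence of good ordinary
primes of an elliptic curve over `ℚ` (`Literature.NumberTheory.EllipticCurves.OrdinaryPrimes`).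

## References

* I. Schur, *Über die Existenz unendlich vieler Primzahlen in einigen speziellen arithmetischen
  Progressionen*, Sitzungsber. Berliner Math. Ges. 11 (1912), 40–50 (the theorem on prime
  divisors of polynomials is the opening lemma of the paper).
* I. Gerst, J. Brillhart, *On the prime divisors of polynomials*, Amer. Math. Monthly 78 (1971),
  250–266 (survey; Schur's theorem and the infinitude of `Spl(f)`).
* O. Bordellès, *Arithmetic Tales* (Universitext, 2012), §3.4.1, p. 80–81 (Euclidean proofs via
  prime divisors of polynomial values; attribution to Schur 1912).
-/

namespace Literature.NumberTheory.Sieve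

open Polynomial
open scoped IntermediateField

/-! ### Schur's theorem -/

/-- A non-constant integer polynomial is unbounded on `ℤ`: for every `B` some value has absolute
value at least `B` (each of the finitely many values `v` with `|v| < B` is taken at most
`deg u` times). [folklore] -/
theorem exists_le_natAbs_eval (u : ℤ[X]) (hu : 0 < u.natDegree) (B : ℕ) :
    ∃ t : ℤ, B ≤ (u.eval t).natAbs := by
  classical
  let S : Finset ℤ :=
    (Finset.Ioo (-(B : ℤ)) B).biUnion fun v => (u - C v).roots.toFinset
  obtain ⟨t, ht⟩ := Infinite.exists_notMem_finset S
  refine ⟨t, ?_⟩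
  by_contra hlt
  push Not at hlt
  apply ht
  simp only [S, Finset.mem_biUnion, Finset.mem_Ioo, Multiset.mem_toFinset]
  refine ⟨u.eval t, ⟨by omega, by omega⟩, ?_⟩
  have hne : u - C (u.eval t) ≠ 0 := by
    intro h
    have h' := congrArg natDegree h
    rw [natDegree_sub_C, natDegree_zero] at h'
    omega
  rw [mem_roots hne, IsRoot, eval_sub, eval_C, sub_self]

/-- **Schur's theorem on prime divisors of polynomials** (1912). For every non-constant
polynomial `f ∈ ℤ[X]` and every `N` there is a prime `p > N` dividing some value `f(a)`,
`a ∈ ℤ`; equivalently the set of primes `p` for which `f` has a root modulo `p` is infinite.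
[cite: Schur1912, opening lemma (prime divisors of an integral polynomial)] -/
theorem schur_exists_prime_dvd_eval (f : ℤ[X]) (hf : 0 < f.natDegree) (N : ℕ) :
    ∃ p : ℕ, p.Prime ∧ N < p ∧ ∃ a : ℤ, (p : ℤ) ∣ f.eval a := by
  classical
  by_cases hc0 : f.eval 0 = 0
  · obtain ⟨p, hp, hprime⟩ := Nat.exists_infinite_primes (N + 1)
    exact ⟨p, hprime, hp, 0, by simp [hc0]⟩
  · set c : ℤ := f.eval 0 with hc
    have hQ : c * (N.factorial : ℤ) ≠ 0 :=
      mul_ne_zero hc0 (by exact_mod_cast (Nat.factorial_pos N).ne')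
    -- the polynomial `t ↦ f (c N! t)` is non-constant, hence takes a value of size `≥ 2|c|`
    have hF : 0 < (f.comp (C (c * (N.factorial : ℤ)) * X)).natDegree := by
      rw [natDegree_comp, natDegree_C_mul_X _ hQ, mul_one]
      exact hf
    obtain ⟨t, ht⟩ := exists_le_natAbs_eval _ hF (2 * c.natAbs)
    simp only [eval_comp, eval_mul, eval_C, eval_X] at ht
    -- `f (c N! t) = c (1 + N! t k)`
    obtain ⟨k, hk⟩ := sub_dvd_eval_sub (c * (N.factorial : ℤ) * t) 0 f
    rw [sub_zero, ← hc] at hk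
    set m : ℤ := 1 + (N.factorial : ℤ) * t * k with hm
    have hval : f.eval (c * (N.factorial : ℤ) * t) = c * m := by
      rw [hm]; linear_combination hk
    rw [hval, Int.natAbs_mul] at ht
    have hm2 : 2 ≤ m.natAbs := by
      have hcpos : 0 < c.natAbs := Int.natAbs_pos.mpr hc0
      nlinarith
    obtain ⟨p, hp, hpm⟩ := Nat.exists_prime_and_dvd (show m.natAbs ≠ 1 by omega)
    have hpm' : (p : ℤ) ∣ m := Int.ofNat_dvd_left.mpr hpm
    refine ⟨p, hp, ?_, c * (N.factorial : ℤ) * t, ?_⟩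
    · by_contra hle
      push Not at hle
      have h1 : (p : ℤ) ∣ (N.factorial : ℤ) := by
        exact_mod_cast Nat.dvd_factorial hp.pos hle
      have h2 : (p : ℤ) ∣ 1 := by
        have : (p : ℤ) ∣ m - (N.factorial : ℤ) * t * k :=
          dvd_sub hpm' (dvd_mul_of_dvd_left (dvd_mul_of_dvd_left h1 _) _)
        simpa [hm] using this
      have := Int.eq_one_of_dvd_one (by positivity) h2
      exact hp.one_lt.ne' (by exact_mod_cast this)
    · rw [hval]
      exact dvd_mul_of_dvd_right hpm' _

/-! ### Primes of complete splitting -/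

/-- In a finite extension `K/ℚ` generated by an element `θ` which is integral over `ℤ`, every
element is of the form `r(θ)/b` with `r ∈ ℤ[X]` and `b ∈ ℤ ∖ {0}` (clear denominators in
`z = q(θ)`, `q ∈ ℚ[X]`). [folklore] -/
theorem exists_int_mul_eq_aeval {K : Type*} [Field K] [Algebra ℚ K] [FiniteDimensional ℚ K]
    {θ : K} (hθ : ℚ⟮θ⟯ = ⊤) (z : K) :
    ∃ b : ℤ, b ≠ 0 ∧ ∃ r : ℤ[X], (b : K) * z = aeval θ r := by
  have hzmem : z ∈ (ℚ⟮θ⟯).toSubalgebra := by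
    rw [IntermediateField.mem_toSubalgebra, hθ]; trivial
  rw [IntermediateField.adjoin_simple_toSubalgebra_of_isAlgebraic
      (Algebra.IsAlgebraic.isAlgebraic θ), Algebra.adjoin_singleton_eq_range_aeval] at hzmem
  obtain ⟨q, hq⟩ := hzmem
  change aeval θ q = z at hq
  obtain ⟨b, hb, hbq⟩ := IsLocalization.integerNormalization_spec (nonZeroDivisors ℤ) q
  refine ⟨b, nonZeroDivisors.ne_zero hb,
    IsLocalization.integerNormalization (nonZeroDivisors ℤ) q, ?_⟩
  rw [← Polynomial.aeval_map_algebraMap ℚ θ, hbq, map_zsmul, hq, zsmul_eq_mul]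

/-- If two polynomials over `ℤ[X]` become equal after substituting an integral element `θ` for
the inner variable, they become equal under any ring map `ψ : ℤ[X] → S` killing the minimal
polynomial of `θ` over `ℤ` (since `ℤ` is integrally closed, `ker (aeval θ) = (minpoly_ℤ θ)`).
[folklore] -/
theorem map_eq_map_of_map_aeval_eq {K S : Type*} [Field K] [CharZero K] [CommRing S] {θ : K}
    (hθ : IsIntegral ℤ θ) (ψ : ℤ[X] →+* S) (hψ : ψ (minpoly ℤ θ) = 0) {P Q : ℤ[X][X]}
    (h : P.map (aeval θ : ℤ[X] →ₐ[ℤ] K).toRingHom = Q.map (aeval θ : ℤ[X] →ₐ[ℤ] K).toRingHom) :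
    P.map ψ = Q.map ψ := by
  ext n
  rw [coeff_map, coeff_map, ← sub_eq_zero, ← map_sub, ← coeff_sub]
  have hn : aeval θ ((P - Q).coeff n) = 0 := by
    have := congrArg (fun R : K[X] => R.coeff n) h
    simp only [coeff_map] at this
    change aeval θ (P.coeff n) = aeval θ (Q.coeff n) at this
    rw [coeff_sub, map_sub, this, sub_self]
  obtain ⟨q, hq⟩ := minpoly.isIntegrallyClosed_dvd hθ hn
  rw [hq, map_mul, hψ, zero_mul]

/-- **Split primes from a splitting field.** If the non-zero integer polynomial `f` splits into
linear factors in a finite extension `K/ℚ`, then for every `N` there is a prime `p > N` such that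
`f mod p` splits into linear factors over `𝔽_p` (Schur's theorem applied to the minimal
polynomial of an integral primitive element of `K`; see the module docstring). [folklore] -/
theorem exists_prime_gt_map_int_splits_of_splits {K : Type*} [Field K] [Algebra ℚ K]
    [FiniteDimensional ℚ K] (f : ℤ[X]) (hf0 : f ≠ 0)
    (hsplitK : (f.map (algebraMap ℤ K)).Splits) (N : ℕ) :
    ∃ p : ℕ, p.Prime ∧ N < p ∧ (f.map (Int.castRingHom (ZMod p))).Splits := by
  classical
  haveI : CharZero K := charZero_of_injective_algebraMap (algebraMap ℚ K).injective
  -- an integral primitive element `θ`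
  obtain ⟨α, hα⟩ := Field.exists_primitive_element ℚ K
  obtain ⟨y, hy0, hθint⟩ :=
    ((IsFractionRing.isAlgebraic_iff ℤ ℚ K).mpr (Algebra.IsAlgebraic.isAlgebraic (R := ℚ) α)
      ).exists_integral_multiple
  set θ : K := y • α with hθdef
  have hθtop : ℚ⟮θ⟯ = ⊤ := by
    rw [eq_top_iff, ← hα, IntermediateField.adjoin_simple_le_iff]
    have hy : (y : K) ≠ 0 := by exact_mod_cast hy0
    have : α = (y : K)⁻¹ * θ := by
      rw [hθdef, zsmul_eq_mul, ← mul_assoc, inv_mul_cancel₀ hy, one_mul]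
    rw [this]
    exact mul_mem (inv_mem (intCast_mem _ y)) (IntermediateField.mem_adjoin_simple_self ℚ θ)
  -- write every root `ρ` of `f` in `K` as `r ρ (θ) / b ρ`
  choose b hb0 r hr using exists_int_mul_eq_aeval hθtop
  set fK : K[X] := f.map (algebraMap ℤ K) with hfK
  set B : ℤ := (fK.roots.map b).prod with hB
  have hB0 : B ≠ 0 := by
    refine Multiset.prod_ne_zero fun h0 => ?_
    obtain ⟨ρ, -, hρ⟩ := Multiset.mem_map.mp h0
    exact hb0 ρ hρ
  have hlc0 : f.leadingCoeff ≠ 0 := leadingCoeff_ne_zero.mpr hf0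
  -- Schur's theorem for `g = minpoly ℤ θ`, with a bound excluding the primes dividing `lc(f) · B`
  obtain ⟨p, hp, hNp, a, hpa⟩ := schur_exists_prime_dvd_eval (minpoly ℤ θ)
    (minpoly.natDegree_pos hθint) (N + (f.leadingCoeff * B).natAbs)
  refine ⟨p, hp, by omega, ?_⟩
  haveI := Fact.mk hp
  have hpdvd : ¬ (p : ℤ) ∣ f.leadingCoeff * B := fun h => by
    have := Nat.le_of_dvd (Int.natAbs_pos.mpr (mul_ne_zero hlc0 hB0)) (Int.ofNat_dvd_left.mp h)
    omega
  have hplc : ((f.leadingCoeff : ℤ) : ZMod p) ≠ 0 := fun h =>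
    hpdvd (dvd_mul_of_dvd_left ((ZMod.intCast_zmod_eq_zero_iff_dvd _ _).mp h) _)
  have hpB : ((B : ℤ) : ZMod p) ≠ 0 := fun h =>
    hpdvd (dvd_mul_of_dvd_right ((ZMod.intCast_zmod_eq_zero_iff_dvd _ _).mp h) _)
  -- evaluation at `a` modulo `p` kills the minimal polynomial of `θ`
  let ψ : ℤ[X] →+* ZMod p := eval₂RingHom (Int.castRingHom (ZMod p)) (a : ZMod p)
  have hψ : ψ (minpoly ℤ θ) = 0 := by
    change eval₂ (Int.castRingHom (ZMod p)) (Int.castRingHom (ZMod p) a) (minpoly ℤ θ) = 0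
    rw [eval₂_at_apply, eq_intCast, ZMod.intCast_zmod_eq_zero_iff_dvd]
    exact hpa
  -- the identity `B · f(Y) = lc(f) · ∏ (b_ρ Y - r_ρ)` in `ℤ[X][Y]`, after substituting `θ` for `X`
  let Φ : ℤ[X] →+* K := (aeval θ : ℤ[X] →ₐ[ℤ] K).toRingHom
  have hΦ : ∀ q : ℤ[X], Φ q = aeval θ q := fun q => rfl
  have hΦC : Φ.comp C = algebraMap ℤ K := RingHom.ext_int _ _
  have hψC : ψ.comp C = Int.castRingHom (ZMod p) := RingHom.ext_int _ _
  let P : ℤ[X][X] := Polynomial.C (C B) * f.map C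
  let Q : ℤ[X][X] := Polynomial.C (C f.leadingCoeff) *
    (fK.roots.map fun ρ => Polynomial.C (C (b ρ)) * X - Polynomial.C (r ρ)).prod
  have hPQ : P.map Φ = Q.map Φ := by
    have hP : P.map Φ = Polynomial.C (B : K) * fK := by
      simp only [P, Polynomial.map_mul, Polynomial.map_C, Polynomial.map_map, hΦC, hfK]
      congr 2
      rw [hΦ, aeval_C, eq_intCast]
    have hQ : Q.map Φ = Polynomial.C (algebraMap ℤ K f.leadingCoeff) *
        (fK.roots.map fun ρ => Polynomial.C (b ρ : K) * (X - Polynomial.C ρ)).prod := by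
      simp only [Q, Polynomial.map_mul, Polynomial.map_C, Polynomial.map_multiset_prod,
        Multiset.map_map]
      congr 2
      · rw [hΦ, aeval_C]
      · refine Multiset.map_congr rfl fun ρ _ => ?_
        simp only [Function.comp_apply, Polynomial.map_sub, Polynomial.map_mul, Polynomial.map_C,
          map_X]
        rw [hΦ, hΦ, aeval_C, eq_intCast, ← hr ρ, C_mul, mul_sub]
    have hprodC : (fK.roots.map fun ρ => Polynomial.C (b ρ : K)).prod = Polynomial.C (B : K) := by
      rw [hB, Int.cast_multiset_prod, map_multiset_prod, Multiset.map_map, Multiset.map_map]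
      rfl
    have hlcK : algebraMap ℤ K f.leadingCoeff ≠ 0 :=
      (map_ne_zero_iff _ (RingHom.injective_int _)).mpr hlc0
    rw [hP, hQ, Multiset.prod_map_mul, hprodC]
    conv_lhs => rw [Splits.eq_prod_roots hsplitK, leadingCoeff_map_of_leadingCoeff_ne_zero _ hlcK]
    ring
  have hPQψ : P.map ψ = Q.map ψ := map_eq_map_of_map_aeval_eq hθint ψ hψ hPQ
  -- the right-hand side is a product of linear factors over `𝔽_p`
  have hQs : (Q.map ψ).Splits := by
    simp only [Q, Polynomial.map_mul, map_C, Polynomial.map_multiset_prod, Multiset.map_map]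
    refine (Splits.C _).mul (Splits.multisetProd fun F hF => ?_)
    obtain ⟨ρ, -, rfl⟩ := Multiset.mem_map.mp hF
    simp only [Function.comp_apply, Polynomial.map_sub, Polynomial.map_mul, map_C, map_X]
    refine Splits.of_degree_le_one ?_
    rw [sub_eq_add_neg, ← C_neg]
    exact degree_linear_le
  have hPψ : P.map ψ = Polynomial.C ((B : ℤ) : ZMod p) * f.map (Int.castRingHom (ZMod p)) := by
    simp only [P, Polynomial.map_mul, map_C, map_map, hψC]
    congr 2
    change eval₂ _ _ (C B) = _
    rw [eval₂_C, eq_intCast]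
  have hfp : f.map (Int.castRingHom (ZMod p)) ≠ 0 := fun h => by
    have := congrArg (fun q => q.coeff f.natDegree) h
    simp only [coeff_map, coeff_natDegree, eq_intCast, coeff_zero] at this
    exact hplc this
  have hne : P.map ψ ≠ 0 := by
    rw [hPψ]; exact mul_ne_zero (C_ne_zero.mpr hpB) hfp
  refine Splits.of_dvd (g := P.map ψ) (by rw [hPQψ]; exact hQs) hne ?_
  rw [hPψ]
  exact dvd_mul_left _ _

/-- **Infinitely many primes of complete splitting** ("poor man's Chebotarev theorem"). For every
non-zero `f ∈ ℤ[X]` and every `N` there is a prime `p > N` such that the reduction of `f` modulo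
`p` is a product of linear factors in `𝔽_p[X]` (Mathlib's `Polynomial.Splits`): apply the previous
theorem to the splitting field of `f` over `ℚ`. Classical consequence of Schur's theorem
(cf. Gerst–Brillhart 1971 for the history). [folklore] -/
theorem exists_prime_gt_map_int_splits (f : ℤ[X]) (hf0 : f ≠ 0) (N : ℕ) :
    ∃ p : ℕ, p.Prime ∧ N < p ∧ (f.map (Int.castRingHom (ZMod p))).Splits := by
  let K := (f.map (algebraMap ℤ ℚ)).SplittingField
  refine exists_prime_gt_map_int_splits_of_splits (K := K) f hf0 ?_ N
  have h : ((f.map (algebraMap ℤ ℚ)).map (algebraMap ℚ K)).Splits := SplittingField.splits _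
  rw [map_map] at h
  convert h using 3
  exact RingHom.ext_int _ _

/-- Alias of `schur_exists_prime_dvd_eval` under the `_holds` naming used for discharged facts.
[cite: Schur1912, opening lemma (prime divisors of an integral polynomial)] -/
theorem schur_exists_prime_dvd_eval_holds :
    ∀ f : ℤ[X], 0 < f.natDegree → ∀ N : ℕ, ∃ p : ℕ, p.Prime ∧ N < p ∧ ∃ a : ℤ, (p : ℤ) ∣ f.eval a :=
  schur_exists_prime_dvd_eval

/-- Alias of `exists_prime_gt_map_int_splits` under the `_holds` naming used for discharged facts.
[folklore] -/
theorem exists_prime_gt_map_int_splits_holds :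
    ∀ f : ℤ[X], f ≠ 0 → ∀ N : ℕ, ∃ p : ℕ, p.Prime ∧ N < p ∧
      (f.map (Int.castRingHom (ZMod p))).Splits :=
  exists_prime_gt_map_int_splits

end Literature.NumberTheory.Sieve
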